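/-
NEW (pub-hodgecm2, COR-CM cell = stage 2 of the Hodge ladder; MODEL-UNIVERSE BUILDER 2 = seat model-2, gen 9).
Capstone of ROAD 2's model layer: the CLOSED 28-field record `ModelAxioms` of the SECOND (iso-complete) model
universe `Model2.universe₂` over the displayed data only — Riemann's theorem `hR` (binder B02 of
`HOME/BINDER-OWNERS.md`, the one hypothesis of `Model2.modelAxioms₂_of_riemann` / `Model2.universe₂_modelAxioms`
besides the display data) is now the tree theorem `deligneMilne1982_Thm_6_20_full_holds`
(`Literature/AlgebraicGeometry/HodgeTheory/AbelianVarietyHodgeFullnessHolds.lean`).  Count-neutral (no BINDER row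
changes; no E-term corollary); the road-2 twin of model-1's `CorCM/Model/ModelAxiomsHolds.lean`.
-/
import Summits.HodgeConjecture.CorCM.Model.Universe2Transfer
import Summits.HodgeConjecture.CorCM.Model.ModelAxiomsOfRiemann
import Literature.AlgebraicGeometry.HodgeTheory.AbelianVarietyHodgeFullnessHolds
import HarnessLib

/-!
# COR-CM, road 2 — the second model universe satisfies `ModelAxioms` (no hypothesis beyond the display data)

For the iso-complete model universe `U₂ := Model2.universe₂ hHD hI hU h₃` (`CorCM/Model/Universe2.lean`: index type
`IsoComplete.Var`, intrinsic content predicates, stage 1's CM / Picard-modular codes verbatim) the structural record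
`U₂.ModelAxioms` (`CorCM/Geometry/Facts.lean`, the 28 fields M01–M28 of stage 1's `MODEL-SCOPE.md`) HOLDS, given only
the displayed data `hHD hI hU h₃` of the universe:

* `Model2.universe₂_modelAxioms_holds` — `Model2.modelAxioms₂_of_riemann` (`CorCM/Model/Universe2Transfer.lean`:
  eleven `Iff.rfl` transfers of the code-level fields from the model of record `Model.universeOf hHD hI hU h₃`, the
  generic fields proved at the iso-complete codes, and M14 `cmDominated` by `universe₂_fact_cmDominated_of_riemann`)
  fed with the model of record's `Model.modelAxioms_of_riemann` (`CorCM/Model/ModelAxiomsOfRiemann.lean`, all 28 rows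
  tree theorems over `hR`, row M22 = `Model.universeOf_algDuality`), both instantiated at Riemann's theorem
  `deligneMilne1982_Thm_6_20_full_holds` ([DeligneMilne1982Tannakian] II Thm. 6.20, fullness of `A ↦ H¹_B(A)`;
  proved in the tree from [LangeBirkenhake1992] Ch. 1 Lemma 1.1.2 / Thm. 1.1.21);
* `Model2.picardCMUniverse₂_modelAxioms` — the same for `Model2.picardCMUniverse₂ hHD hI h₁ h₃`
  (`= universe₂ hHD hI (ballQuotientUniformisedDatum_of h₁) h₃` by `rfl`), over exactly the cited records
  (ii-a) `h₁`, (iii) `h₃`.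

So BOTH model universes of the cell — the model of record `Model.universeOf` (model-1's
`CorCM/Model/ModelAxiomsHolds.lean`) and the second construction `Model2.universe₂` (this file) — carry their
`ModelAxioms` over the display data alone; the two constructions are comparable field by field
(`Model2.fact_*_iff`, `CorCM/Model/Universe2Facts.lean`).  Nothing is asserted: every field is a hub-tree theorem;
axioms `propext`, `Classical.choice`, `Quot.sound`.

## References

* P. Deligne, J. S. Milne, *Tannakian categories*, in LNM 900 (1982), II Thm. 6.20. [DeligneMilne1982Tannakian]
* H. Lange, Ch. Birkenhake, *Complex Abelian Varieties*, Grundlehren 302 (1992), Ch. 1 §1. [LangeBirkenhake1992]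
-/

noncomputable section

namespace Summit.HodgeConjecture.CorCM

namespace Model2

open Literature.NumberTheory.Automorphic.PicardCM (BallQuotientUniformisedDatum CMAbelianVarietyRealised
  BallQuotientUniformised ballQuotientUniformisedDatum_of)
open Literature.AlgebraicGeometry.HodgeTheory

/-- **The second model universe satisfies `ModelAxioms`** — no hypothesis beyond the display data `hHD hI hU h₃`:
all 28 fields of `(universe₂ hHD hI hU h₃).ModelAxioms` are tree theorems — `modelAxioms₂_of_riemann` applied to the
model of record's `Model.modelAxioms_of_riemann`, with Riemann's theorem (Deligne–Milne 1982 II Thm. 6.20, formerly the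
displayed binder `hR`, used by rows M14/M20/M21 only) supplied by the tree theorem `deligneMilne1982_Thm_6_20_full_holds`.
[cite: DeligneMilne1982Tannakian, II Thm. 6.20] -/
theorem universe₂_modelAxioms_holds (hHD : exists_isReal_hodgeModel) (hI : hodgePQ_independent_of_hodgeModel)
    (hU : BallQuotientUniformisedDatum) (h₃ : CMAbelianVarietyRealised) :
    (universe₂ hHD hI hU h₃).ModelAxioms :=
  modelAxioms₂_of_riemann hHD hI hU h₃
    (Model.modelAxioms_of_riemann hHD hI hU h₃ deligneMilne1982_Thm_6_20_full_holds)
    deligneMilne1982_Thm_6_20_full_holds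

/-- **The iso-complete Picard–CM model universe satisfies `ModelAxioms`**: the same statement for
`Model2.picardCMUniverse₂ hHD hI h₁ h₃` (which is `universe₂ hHD hI (ballQuotientUniformisedDatum_of h₁) h₃` by `rfl`),
over exactly the cited records (ii-a) `h₁ : BallQuotientUniformised` and (iii) `h₃ : CMAbelianVarietyRealised`. [folklore] -/
theorem picardCMUniverse₂_modelAxioms (hHD : exists_isReal_hodgeModel) (hI : hodgePQ_independent_of_hodgeModel)
    (h₁ : BallQuotientUniformised) (h₃ : CMAbelianVarietyRealised) :
    (picardCMUniverse₂ hHD hI h₁ h₃).ModelAxioms :=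
  universe₂_modelAxioms_holds hHD hI (ballQuotientUniformisedDatum_of h₁) h₃

end Model2

end Summit.HodgeConjecture.CorCM

end
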